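import Literature.NumberTheory.EllipticCurves.BSDSelmerSmithNormalisationProofs
import HarnessLib

/-!
# bsd.S34 (Smith, arXiv:2503.17619, Thm. 1.1): scope of the named fact — elliptic curves only

A `…Proofs` companion (theorems only: no definition, no named fact, no instance) of
`Literature.NumberTheory.EllipticCurves.BSDSelmer` §bsd.S34. The named fact
`smith_selmerCorank_density` was written under `variable (W : WeierstrassCurve ℚ) [W.IsElliptic]`,
but its body does not use the instance, so Lean omitted the binder: the declared constant is a
predicate `smith_selmerCorank_density : WeierstrassCurve ℚ → Prop` on **all** Weierstrass cubics
over `ℚ`, singular ones included. Two machine-checked remarks on what a discharge of bsd.S34 can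
and must say:

* `not_forall_smith_selmerCorank_density` — **the literal universal closure
  `∀ W, smith_selmerCorank_density W` is false**: the cuspidal cubic `y² = x³` violates the
  predicate (`not_smith_selmerCorank_density_cusp`, `BSDSelmerSmithDensityProofs`: all its
  "twists" coincide, so no corank class has density `1/2`). So the only closed reading of the
  fact that can hold is the one over *elliptic* `W`,
  `∀ (W : WeierstrassCurve ℚ) [W.IsElliptic], smith_selmerCorank_density W`, and a discharge must
  carry the binder `[W.IsElliptic]`.
* `forall_smith_selmerCorank_density_iff_printed` — **that closed reading is Smith's Theorem 1.1
  verbatim**: A. Smith, *The Birch and Swinnerton-Dyer conjecture implies Goldfeld's conjecture*,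
  arXiv:2503.17619 (2025), Thm. 1.1 (p. 3): "Given an elliptic curve `E/ℚ` and a nonnegative
  integer `r`, we have `lim_{H → ∞} #{d ∈ ℤ^{≠0} : |d| ≤ H and r_{2^∞}(E^d) = r} / 2H = 1/2` if
  `r = 0` or `r = 1`, `0` if `r ≥ 2`" — the hypothesis "elliptic" being the *only* hypothesis of
  the theorem (the restrictions on `E(ℚ)[2]` and isogenies of Smith's earlier arXiv:1702.02325,
  arXiv:2207.05674 are removed in this paper, §1.1), and the tree's density over squarefree `d`
  being equivalent, curve by curve, to the printed normalisation over all `d ∈ ℤ^{≠0}`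
  (`smith_selmerCorank_density_iff_printed`, `BSDSelmerSmithNormalisationProofs`).

Nothing here proves Thm. 1.1: its printed proof (Cases I–II by arXiv:2207.05674 with
arXiv:2207.05143; Cases IV–V by Thm. 1.7 via Thm. 1.17, §§2–6, and the isogeny trick Prop. 1.18;
Case III by the isogeny invariance (1.3), cf. `SelmerCorankIsogenyProofs`) is a theory of its
own, of which the tree holds the §1 consequences and reductions (`BSDSelmerSmith*Proofs`).

## References

* [arXiv250317619] A. Smith, *The Birch and Swinnerton-Dyer conjecture implies Goldfeld's
  conjecture*, arXiv:2503.17619 (2025): §1, Thm. 1.1 (p. 3), Notation 1.8 (p. 4), §1.1.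
-/

noncomputable section

open scoped Classical
open Filter Topology

namespace Literature.NumberTheory.EllipticCurves

/-- **The literal universal closure of `smith_selmerCorank_density` is false**: the predicate
fails for the (singular) cuspidal cubic `y² = x³` (`not_smith_selmerCorank_density_cusp`). Hence
a discharge of bsd.S34 must quantify over *elliptic* `W` only:
`∀ (W : WeierstrassCurve ℚ) [W.IsElliptic], smith_selmerCorank_density W`. [folklore] -/
theorem not_forall_smith_selmerCorank_density :
    ¬ ∀ W : WeierstrassCurve ℚ, smith_selmerCorank_density W :=
  fun h ↦ not_smith_selmerCorank_density_cusp (h _)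

/-- **The closed reading over elliptic curves is Smith's Theorem 1.1 as printed** (A. Smith,
arXiv:2503.17619 (2025), **Thm. 1.1**, p. 3: "Given an elliptic curve `E/ℚ` and a nonnegative
integer `r`, we have `lim_{H → ∞} #{d ∈ ℤ^{≠0} : |d| ≤ H and r_{2^∞}(E^d) = r} / 2H = 1/2` if
`r = 0` or `r = 1`, `0` if `r ≥ 2`"): `smith_selmerCorank_density W` for every elliptic `W / ℚ`
holds iff, for every elliptic `W / ℚ` and in the printed normalisation (all `d ∈ ℤ^{≠0}` with
`|d| ≤ H`, denominator `2H`), the proportion of twists `W^d` with `2^∞`-Selmer corank `0` tends to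
`1/2`, with corank `1` tends to `1/2`, and with corank `r` tends to `0` for each `r ≥ 2`
(`smith_selmerCorank_density_iff_printed`, curve by curve). [cite: arXiv250317619, Thm. 1.1 (p. 3)] -/
theorem forall_smith_selmerCorank_density_iff_printed :
    (∀ (W : WeierstrassCurve ℚ) [W.IsElliptic], smith_selmerCorank_density W) ↔
      ∀ (W : WeierstrassCurve ℚ) [W.IsElliptic],
        (Tendsto (fun H : ℕ ↦ (Nat.card {d : ℤ | d ≠ 0 ∧ |d| ≤ (H : ℤ) ∧
            selmerCorankTwoInfty (W.quadraticTwist d) = 0} : ℝ) / (2 * H)) atTop (𝓝 (1 / 2)) ∧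
          Tendsto (fun H : ℕ ↦ (Nat.card {d : ℤ | d ≠ 0 ∧ |d| ≤ (H : ℤ) ∧
            selmerCorankTwoInfty (W.quadraticTwist d) = 1} : ℝ) / (2 * H)) atTop (𝓝 (1 / 2)) ∧
          ∀ r : ℕ, 2 ≤ r → Tendsto (fun H : ℕ ↦ (Nat.card {d : ℤ | d ≠ 0 ∧ |d| ≤ (H : ℤ) ∧
            selmerCorankTwoInfty (W.quadraticTwist d) = r} : ℝ) / (2 * H)) atTop (𝓝 0)) :=
  ⟨fun h W _ ↦ (smith_selmerCorank_density_iff_printed W).1 (h W),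
    fun h W _ ↦ (smith_selmerCorank_density_iff_printed W).2 (h W)⟩

end Literature.NumberTheory.EllipticCurves

end
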